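import Mathlib

/-!
# STUB-IDEAS k2 (gen 16) — Lean sketch for `stub_heegnerIndexLowerAtTwo` (crux 27851)

R121″ EXECUTED AT THE 𝔭-LOCAL COLUMN, for every in-range point `m ≥ 1` and both
conductor exponents `n_v ∈ {2,3}`:

* §A  the m-SHIFT MATCH (typed dictionary): de Shalit II.4.14 (37)
      `G(ε) = φᵏφ̄ʲ(𝔭ⁿ)/pⁿ · Σ χ(γ)(ς_n^γ)⁻¹`  ↔  Liu–Zhang–Zhang Def 1.5 / Thm 1.6
      `χ^{(ι)}_𝔭(t) = ι((t_𝔓/t_{𝔓ᶜ})^{-w} χ_𝔭(t))`,  `ε(½,ψ,π_𝔭 ⊗ χ^{(ι)}_{𝔓ᶜ}) / L(½,…)²`,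
      bookkept in DOUBLED 2-adic valuations (all entries integers);
* §B  the ORIENTATION ORACLE: ultrametric eventual constancy of `‖u(χ′ν^{2^t})‖` forces every
      m-linear valuation digit of a closed form for `u` to vanish — so the sign conventions of
      de Shalit 4.13 `(ς_n)` / Tate's `ε` never have to be chased;
* §C  the BDP–PJM Thm 2.13 template ((57)–(58)): which columns cancel identically and why the
      survivor `2^{-(r+1+2j)}` is a p = 2 CONVENTION ARTEFACT (κ of B17), by §B;
* §D  the R130 census record: the n_v-coefficient `b` of `v₂ u(d)` is `0`.

Pure bookkeeping + one genuine analytic lemma (§B); no tree declaration is concluded;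
`sorry`-free.  BSD is NOT proved by any of this.
-/

set_option linter.dupNamespace false

namespace Summit.BirchSwinnertonDyer.BirchSwinnertonDyer.Cruxes.SplitBadTwoLowerHalfOfFacts.HeegnerIndexTwo.K2G16

open Filter Topology

/-! ## §A  The 𝔭-local column: Katz pair versus LZZ epsilon factor (doubled valuations) -/

/-- Doubled 𝔭-adic valuation of de Shalit's like-Gauss-sum `G(ε)` for `ε` of type `(k, j)`,
`0 ≤ -j < k`, exact 𝔭-conductor exponent `n`:  `2·[(nk − n) + n/2] = n(2k − 1)`
(φᵏ(𝔭ⁿ) has valuation `nk`, φ̄ʲ(𝔭ⁿ) valuation `0`, `p⁻ⁿ` gives `−n`, the root-of-unity sum `n/2`).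
[de Shalit 1987 II.4.11 (30) + Remark (i) p. 65; II.4.14 (37) p. 71] -/
def dvG (n k : ℤ) : ℤ := n * (2 * k - 1)

theorem dvG_eq (n k : ℤ) : dvG n k = 2 * (n * k - n) + n := by
  unfold dvG; ring

/-- Norm law check `G·Ḡ = p^{n(k+j−1)}` in doubled valuations: `v_𝔭 G + v_𝔭̄ G = n(k+j−1)`,
with `2 v_𝔭̄ G = n(2j − 1)` by the symmetric computation. [II.4.11 Remark (i), p. 65] -/
theorem normLaw_doubled (n k j : ℤ) : dvG n k + n * (2 * j - 1) = 2 * (n * (k + j - 1)) := by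
  unfold dvG; ring

/-- THE KATZ PAIR at the in-range point `m ≥ 1`: types `(1+m, −m)` and `(m, 1−m)`;
doubled 𝔭-valuation of `G(ε₁)G(ε₂)` is `4·n·m` (valuation `2nm`): m-LINEAR, constant part `0`. -/
theorem katzPair_gauss (n m : ℤ) : dvG n (m + 1) + dvG n m = 4 * n * m := by
  unfold dvG; ring

/-- Doubled valuation of the LZZ multiplier `ε(½,ψ,π_𝔭⊗θ)/L(½,π_𝔭⊗θ)²` at weight `w`, conductor
exponent `n` of `θ = χ^{(ι)}_{𝔓ᶜ}`:  `π_𝔭 = π(μ₁,μ₂)` unramified principal series (good partner),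
`ε(π_𝔭⊗θ) = ε(μ₁θ)ε(μ₂θ) = ω_π(ϖ)ⁿ·ε(θ)²` [Gelbart 1975 table p. 74], Langlands' rule
`W(θ₀φ) = φ(𝔣(θ₀))·W(θ₀)` for `φ` unramified [Bushnell–Fröhlich 1983 (2.5.3)–(2.5.4) p. 19],
`W(θ₀)² = θ₀(−1)` for self-dual `θ₀` [(2.4.11)], `L = 1` (ramified), and
`ι⁻¹θ(ϖ) = 2ʷ·unit` [LZZ Def 1.5, p. 4]: the entries are
`vOmega·n` (central character, `0` here) + `2·(2·n·w)` (the weight twist, squared over the two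
constituents) + `0` (`W(θ₀)²`, a sign) + `0` (`L⁻²`). -/
def dvEpsLZZ (n w vOmega : ℤ) : ℤ := vOmega * n + 2 * (2 * n * w) + 0 + 0

/-- R121″'s m-SHIFT MATCH: at `w = m` and `vOmega = 0` the 𝔭-local column of
`u = Katz·Katz / 𝓛(π)` has doubled valuation `0` for EVERY `m` and EVERY `n`. -/
theorem local_column_cancels (n m : ℤ) :
    (dvG n (m + 1) + dvG n m) - dvEpsLZZ n m 0 = 0 := by
  unfold dvG dvEpsLZZ; ring

/-- … hence the n_v-coefficient of the 𝔭-local column is `0` (R130: `b_Gauss = 0`), uniformly in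
the key (`n_v = 2` on δ = −1, `n_v = 3` on δ = ±2). -/
theorem gauss_coeff_of_nv_zero (m : ℤ) :
    ∀ n : ℤ, (dvG n (m + 1) + dvG n m) - dvEpsLZZ n m 0 = 0 * n := by
  intro n; rw [local_column_cancels]; ring

/-- What k2-g15's weight-0 reading missed at in-range points: dropping the weight twist
(`w = 0` on the LZZ side) leaves an m-linear residue `4nm` — exactly the critic's «2nm» column. -/
theorem residue_if_twist_dropped (n m : ℤ) :
    (dvG n (m + 1) + dvG n m) - dvEpsLZZ n 0 0 = 4 * n * m := by
  unfold dvG dvEpsLZZ; ring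

/-! ## §B  The orientation oracle: ultrametric eventual constancy -/

section Ultrametric

variable {E : Type*} [SeminormedAddCommGroup E] [IsUltrametricDist E]

/-- «The strongest wins»: `‖a − b‖ < ‖b‖ ⟹ ‖a‖ = ‖b‖`. (Same device as k3-g8 H1; restated
Mathlib-only so this file is self-contained.) -/
theorem norm_eq_of_norm_sub_lt {a b : E} (h : ‖a - b‖ < ‖b‖) : ‖a‖ = ‖b‖ := by
  apply le_antisymm
  · calc ‖a‖ = ‖b + (a - b)‖ := by rw [add_sub_cancel]
      _ ≤ max ‖b‖ ‖a - b‖ := IsUltrametricDist.norm_add_le_max _ _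
      _ = ‖b‖ := max_eq_left h.le
  · by_contra hlt
    push Not at hlt
    have h1 : ‖b‖ ≤ max ‖a‖ ‖-(a - b)‖ := by
      calc ‖b‖ = ‖a + -(a - b)‖ := by rw [← sub_eq_add_neg, sub_sub_cancel]
        _ ≤ max ‖a‖ ‖-(a - b)‖ := IsUltrametricDist.norm_add_le_max _ _
    rw [norm_neg] at h1
    exact absurd h1 (not_le.mpr (max_lt hlt h))

end Ultrametric

/-- EVENTUAL CONSTANCY OF THE NORM along a convergent sequence of evaluation points:
if `x_t → x₀`, `u` is continuous at `x₀` and `u x₀ ≠ 0`, then `‖u(x_t)‖ = ‖u x₀‖` for all large `t`.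
Application: `x_t = χ′·ν^{2^t·e} → χ′` (weight `m_t = 2^t e → 0` 2-adically), `u = Katz·Katz/𝓛(π)`
restricted to the anticyclotomic line, `u(χ′) ≠ 0, ∞` by (W-c) ∧ (W-0) ∧ p-adic Waldspurger. -/
theorem eventually_norm_eq {E : Type*} [NormedAddCommGroup E] [IsUltrametricDist E]
    {X : Type*} [TopologicalSpace X] {u : X → E} {x : ℕ → X} {x₀ : X}
    (hx : Tendsto x atTop (𝓝 x₀)) (hu : ContinuousAt u x₀) (h0 : u x₀ ≠ 0) :
    ∀ᶠ t in atTop, ‖u (x t)‖ = ‖u x₀‖ := by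
  have h1 : Tendsto (fun t => u (x t)) atTop (𝓝 (u x₀)) := hu.tendsto.comp hx
  have hpos : 0 < ‖u x₀‖ := norm_pos_iff.mpr h0
  have h2 : ∀ᶠ t in atTop, dist (u (x t)) (u x₀) < ‖u x₀‖ :=
    (Metric.tendsto_nhds.mp h1) _ hpos
  refine h2.mono fun t ht => ?_
  rw [dist_eq_norm] at ht
  exact norm_eq_of_norm_sub_lt ht

/-- LINEAR DIGITS VANISH: a closed form `a + b·m` for the (doubled) valuation of `u` at the points
`m = 2^t` that is eventually constant has `b = 0`. -/
theorem linear_digit_zero {a b c : ℤ} {T : ℕ}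
    (h : ∀ t : ℕ, T ≤ t → a + b * (2 : ℤ) ^ t = c) : b = 0 := by
  have h1 := h T le_rfl
  have h2 := h (T + 1) (Nat.le_succ T)
  rw [pow_succ] at h2
  have h3 : b * (2 : ℤ) ^ T = 0 := by linarith
  rcases mul_eq_zero.mp h3 with hb | hp
  · exact hb
  · exact absurd hp (pow_ne_zero _ two_ne_zero)

/-- THE ORACLE applied to the 𝔭-local column: whatever sign `s ∈ {±1}` a reader attaches to the
LZZ weight twist (Tate's `θ(ϖ)^{±a(θ)}`, or 𝔓 versus 𝔓ᶜ), eventual constancy along `m = 2^t`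
FORCES `s = 1`, i.e. exact cancellation against de Shalit's `+2nm`. -/
theorem orientation_forced {n s a c : ℤ} {T : ℕ} (hn : 0 < n) (hs : s = 1 ∨ s = -1)
    (h : ∀ t : ℕ, T ≤ t → a + (4 * n - s * (4 * n)) * (2 : ℤ) ^ t = c) : s = 1 := by
  have hb : 4 * n - s * (4 * n) = 0 := linear_digit_zero h
  rcases hs with rfl | rfl
  · rfl
  · exfalso; linarith

/-! ## §C  The BDP–PJM Theorem 2.13 template (p ∤ conductor): what cancels identically -/

/-- Periods: `Ω_p^{2(k+2j)} = Ω_p^{1+2j}·Ω_p^{1+2(1+r+j)}`, `k = r + 2`. [PJM 2012 (58), p. 22] -/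
theorem bdp_periods_cancel (r j : ℤ) :
    2 * ((r + 2) + 2 * j) = (1 + 2 * j) + (1 + 2 * (1 + r + j)) := by ring

/-- √D powers: `√D^{r+1+2j} = √D^{j}·√D^{1+r+j}`. [PJM 2012 (57), p. 22]  (For K₀ = ℚ(√−7),
`√−7` is a 2-adic unit anyway.) -/
theorem bdp_sqrtD_cancel (r j : ℤ) : r + 1 + 2 * j = j + (1 + r + j) := by ring

/-- The surviving 2-power of (55): `2^{-(r+1+2j)}`; in the in-range parameter `m = j + 1`
it reads `-(2m − 1) − r` — m-LINEAR. -/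
def bdpTwoExp (r j : ℤ) : ℤ := -(r + 1 + 2 * j)

theorem bdpTwoExp_in_m (r m : ℤ) : bdpTwoExp r (m - 1) = -(2 * m - 1) - r := by
  unfold bdpTwoExp; ring

/-- … and therefore NOT eventually constant along `m = 2^t`: by §B it cannot be a digit of the
2-adic comparison element `u`; it is the `π^{r+2j+1}` (BDP (45)) versus `(2π)^{…}` (Katz (36))
CONVENTION — the carrier bit κ of B17 — and must be booked before any p = 2 transplant of (55). -/
theorem bdpTwoExp_not_eventually_const (r : ℤ) (T : ℕ) :
    bdpTwoExp r ((2 : ℤ) ^ (T + 1) - 1) ≠ bdpTwoExp r ((2 : ℤ) ^ T - 1) := by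
  unfold bdpTwoExp
  have hp : (0 : ℤ) < 2 ^ T := pow_pos two_pos T
  rw [pow_succ]
  intro h
  linarith

/-- The V-digit of B17 in the same template: `δ_c = ∏_{q∣c}(q − ε_K(q))²` has doubled valuation
`4·V`, `V = Σ v₂(q − ε_K(q))`; it is m-CONSTANT, so §B says nothing about it — it is a genuine
(convention-dependent: sum versus normalised average, κ ∈ {0,1}) digit, LZZ side κ = 0
[LZZ p. 18 L101 «Haar measure of total volume 1»; p. 23 L18–22 normalised average]. -/
theorem vDigit_untouched_by_oracle (V κ : ℤ) (a c : ℤ) (T : ℕ)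
    (h : ∀ t : ℕ, T ≤ t → (a + 4 * κ * V) + 0 * (2 : ℤ) ^ t = c) : a + 4 * κ * V = c := by
  have := h T le_rfl; simpa using this

/-! ## §D  R130 census: the n_v-carriers of `v₂ u(d)` -/

/-- One row per factor of de Shalit (36)–(37) × LZZ Thm 1.6 that COULD depend on the conductor
exponent `n_v`; the entry is its n_v-coefficient in the doubled valuation of `u`. -/
structure NvLedger where
  /-- Katz `G(ε₁)G(ε₂)` versus LZZ `ε/L²` (§A: cancels exactly) -/
  bGauss : ℤ
  /-- Katz Euler factors `(1 − ε(𝔭)/p)`, removed factor at 𝔭̄: both `= 1` for ramified ε -/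
  bEuler : ℤ
  /-- de Shalit's measure `μ(𝔤𝔭̄^∞)`: no `N𝔣`/`w_𝔣` factor in (36) (the `12(σ_𝔞 − N𝔞)` of (29)
  is divided out in 4.12); 𝔭̄-ramification absorbed in `𝔭̄^∞` -/
  bMeasure : ℤ
  /-- LZZ `( , )_χ` and the universal torus period: NORMALISED averages over
  `E^×\A_E^{∞×}/V^p O^×_{E_𝔭,m}` (p. 23), Haar measure of volume 1 — level-free -/
  bPairing : ℤ
  /-- LZZ constants `2^{g−3} δ_E^{1/2} ζ_F(2) / (L(1,η)² L(1,π,Ad))`: χ-free -/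
  bConst : ℤ

/-- Total n_v-coefficient `b` of R130's trichotomy `λ = a₀ + b·n_v`. -/
def NvLedger.b (L : NvLedger) : ℤ := L.bGauss + L.bEuler + L.bMeasure + L.bPairing + L.bConst

/-- The ledger OF RECORD read off the pages this session. -/
def ledgerOfRecord : NvLedger := ⟨0, 0, 0, 0, 0⟩

theorem R130_b_eq_zero : ledgerOfRecord.b = 0 := by decide

/-- DECISION of the currency trichotomy `b ∈ {0, −1, +1}` (k2-g15 / R130): `b = 0`; in
particular `v₂ u(d)` does NOT separate the `n_v = 2` keys from the `n_v = 3` keys. The remaining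
m-constant digits (`s₀` of R83, `κ·V(d)` of B17, the Petersson/`L(1,π,Ad)` column of the partner)
are KEY-TYPED and n_v-free. -/
theorem trichotomy_decided : ledgerOfRecord.b = 0 ∧ ledgerOfRecord.b ≠ 1 ∧ ledgerOfRecord.b ≠ -1 := by
  refine ⟨R130_b_eq_zero, ?_, ?_⟩ <;> decide

/-- If a by-hand reader nevertheless finds `b ≠ 0`, §A–§D localise the discrepancy: it can only
come from a factor NOT in the ledger (a hidden level-dependence of `ω_{ψ±}` at a ramified `χ_𝔭`,
LZZ (3.?) `ω_{ψ±} = Υ_±^* ω_ν|_{Y±}`), since every listed row is `0`. -/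
theorem discrepancy_localised (bHidden : ℤ) (hb : ledgerOfRecord.b + bHidden ≠ 0) : bHidden ≠ 0 := by
  rw [R130_b_eq_zero, zero_add] at hb; exact hb

end Summit.BirchSwinnertonDyer.BirchSwinnertonDyer.Cruxes.SplitBadTwoLowerHalfOfFacts.HeegnerIndexTwo.K2G16
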